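import Literature.NumberTheory.GaloisRepresentations.ArtinConductorExponentHasseArfProofs
import Literature.RepresentationTheory.FiniteGroups.BrauerCharacter
import HarnessLib

/-!
# Artin's theorem over coefficient fields of characteristic `ℓ ≠ p` from the Hasse–Arf theorem:
the modular step via Brauer characters (trunk GalRep, item C10; provefact
`exists_natCast_eq_artinExponent`)

Theorems only (no definitions, no named facts).  The named fact
`Literature.NumberTheory.GaloisRepresentations.exists_natCast_eq_artinExponent` (`ArtinConductorIntegrality.lean`: Artin's
theorem `f(τ) = Σ_i (g_i/g_0) codim M^{G_i} ∈ ℕ` for a representation `τ` of the inertia group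
`G_0 = I(𝔓_E)` at a prime of a number field, over any field `A` with `(q_v : A) ≠ 0`; Serre,
*Local Fields*, VI §2 Thm 1' with Cor. 1'; Katz, Prop. 1.9) was reduced in the tree
(`ArtinRepresentationHasseArfProofs.exists_natCast_eq_artinExponent_of_hasseArf`) to two named facts:
the Hasse–Arf theorem `Literature.NumberTheory.GaloisRepresentations.hasseArf` and — for coefficient fields of positive
characteristic only — Artin's theorem over *finite* coefficient fields,
`Literature.NumberTheory.GaloisRepresentations.exists_natCast_eq_artinExponent_finiteField` (Katz 1.9 for `A = 𝔽_λ`, whose printed proof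
is Serre, *Linear Representations* §19.3 via the projectivity of the Swan representation, Thm 44).
This file **removes the second leaf**: the finite-field fact follows from the same two arithmetic
inputs (D) = `card_inf_inertia_dvd_finsum_lowerIndex` (proved in the tree) and
(HA) = `card_inf_inertia_dvd_finsum_card_inf_ramificationSubgroup` (reduced in the tree to
`hasseArf`) as the characteristic-`0` case, by the classical detour through **Brauer characters**
(Serre, *Linear Representations*, §18.1, §18.4 Thm 43 (i);
`Literature.RepresentationTheory.FiniteGroups.exists_brauerCharacter`) instead of the Swan
representation:

* `card_dvd_sum_card_mul_codimFixed_modular` — the modular counterpart of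
  `card_dvd_sum_card_mul_codimFixed_of_brauer`: for a finite group `Γ` filtered by `F_i` with the
  weight `ι` and inputs (D), (HA) in numerator form, and a matrix representation over a finite field
  `k` of characteristic `ℓ` such that the `F_i ≠ Γ` have order prime to `ℓ`,
  **`|Γ| ∣ Σ_{i<N} |F_i| codim (kⁿ)^{F_i}`**.  Proof: the extended Brauer character `φ` of the
  representation is a virtual character (Thm 43 (i)), so `Σ_s ι(s)(φ(1) − φ(s)) ∈ |Γ|ℤ` by the
  characteristic-`0` core applied to characters and linearity; double counting (VI §2 Cor. 1)
  turns this into `Σ_i Σ_{s ∈ F_i}(φ(1) − φ(s))`, whose `i`-th term is `|F_i| codim (kⁿ)^{F_i}` when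
  `F_i ≠ Γ` (§18.1 (ix): `Σ_{s ∈ F_i} φ(s) = |F_i| dim (kⁿ)^{F_i}`) and `≡ 0 (mod |Γ|)` when `F_i = Γ`
  (`⟨φ, 1⟩ ∈ ℤ`), as is `|Γ| codim`;
* `card_inertia_dvd_sum_modular`, `exists_natCast_eq_artinExponent_core_finite` — the instantiation
  at a maximal ideal of a Dedekind extension (transport of `G_0` to universe `0`; `F_0 = Γ` and the
  `G_i`, `i ≥ 1`, are `p`-groups, `p ≠ ℓ`), and Artin's theorem over a finite coefficient field
  from (D), (HA) via a matrix model (`exists_matrix_model`);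
* `exists_natCast_eq_artinExponent_finiteField_of_arith`, `…_finiteField_of_hasseArf` — the named
  fact `exists_natCast_eq_artinExponent_finiteField` from (D), (HA), resp. from `hasseArf` alone;
* `exists_natCast_eq_artinExponent_of_arith`, **`exists_natCast_eq_artinExponent_of_hasseArf'`** —
  Artin's theorem for every coefficient field with `(q_v : A) ≠ 0` from (D), (HA), resp. **from
  `hasseArf` alone** (Brauer's induction theorem being proved in the tree,
  `Literature.RepresentationTheory.FiniteGroups.brauer_induction_holds`); once `hasseArf` is
  discharged, `exists_natCast_eq_artinExponent_holds := exists_natCast_eq_artinExponent_of_hasseArf' hasseArf_holds`;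
* `GaloisRep.exists_natCast_eq_artinConductorAt_of_hasOpenInertiaKerAt_of_hasseArf'`,
  `GaloisRep.natCast_artinConductorExponent_of_t2Space_of_hasseArf'`,
  `GaloisRep.natCast_artinConductorExponent_of_hasOpenInertiaKerAt_of_hasseArf'` — the corrected
  Artin–Katz integrality statements of `ArtinConductor.lean` in all coefficient characteristics
  `≠ p` from `hasseArf` alone (previously: `hasseArf` and the finite-field fact).

Remaining trust base of all of these: `Literature.NumberTheory.GaloisRepresentations.hasseArf` (Serre IV §3; V §7 Thm 1), a
named fact of `ArtinRepresentation.lean`.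

## References

* J.-P. Serre, *Local Fields*, GTM 67 (1979), Ch. IV §1 Cor. to Prop. 4, §3 Theorem
  (Hasse–Arf); Ch. VI §2, Props. 2–5, Thm 1' and its proof (p. 103). [SerreLocalFields1979]
* J.-P. Serre, *Linear Representations of Finite Groups*, GTM 42 (1977), §18.1 (i), (ii), (ix),
  §18.4 Thm 43 (i), §19.3. [SerreLinearRepresentations1977]
* N. M. Katz, *Gauss Sums, Kloosterman Sums, and Monodromy Groups* (1988), Ch. 1, Prop. 1.9 and
  its proof, Remark 1.10. [Katz1988]
-/

noncomputable section

namespace Literature.NumberTheory.GaloisRepresentations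

open Finset Module IsDedekindDomain
open Literature.RepresentationTheory.FiniteGroups

/-! ## The modular core: `|Γ| ∣ Σ_i |F_i| codim M^{F_i}` over a finite field -/

section ModularCore

universe v

variable {Γ : Type} [Group Γ] [Fintype Γ]

open scoped Classical in
/-- **Artin's theorem over a finite coefficient field, combinatorial core** (Serre, *Linear
Representations*, §18.4 Thm 43 (i) combined with *Local Fields* VI §2, proof of Thm 1'; this is
the content of Katz's Prop. 1.9 for `A = 𝔽_λ` / Serre *LinRep* §19.3 (iii), obtained here without
the Swan representation).  Setting of `card_dvd_sum_card_mul_codimFixed_of_brauer` (a finite group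
`Γ` with a filtration `F_i` and weight `ι`, the arithmetic inputs (D) and (HA) in numerator form),
over a finite field `k` of characteristic `ℓ` such that every `F_i ≠ Γ`, `i < N`, has order prime
to `ℓ`.  Then for every matrix representation `τ` of `Γ` over `k`,
**`|Γ|` divides `Σ_{i<N} |F_i| · codim (kⁿ)^{F_i}`**.  Proof: let `φ ∈ R(Γ)` be the extended Brauer
character of `τ` (`exists_brauerCharacter`).  By the characteristic-`0` core applied to the
characters of complex representations and linearity, `Σ_s ι(s)(φ(1) − φ(s)) ∈ |Γ|ℤ`; by double
counting this is `Σ_{i<N} Σ_{s ∈ F_i} (φ(1) − φ(s))`; for `F_i = Γ` the inner sum is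
`|Γ|(φ(1) − ⟨φ, 1⟩) ∈ |Γ|ℤ` and `|F_i| codim` is a multiple of `|Γ|`; for `F_i ≠ Γ` it is
`|F_i| · n − |F_i| dim (kⁿ)^{F_i} = |F_i| codim (kⁿ)^{F_i}` (Serre §18.1 (ix)).
[cite: SerreLinearRepresentations1977, §18.4 Thm 43 (i) and §18.1 (ix)]
[cite: SerreLocalFields1979, Ch. VI §2, Thm 1' (proof)] -/
theorem card_dvd_sum_card_mul_codimFixed_modular (F : ℕ → Subgroup Γ) (N : ℕ) (ι : Γ → ℕ)
    (hι : ∀ s, s ≠ 1 → ι s = ((range N).filter fun i => s ∈ F i).card)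
    (hconj : ∀ s t : Γ, ι (t⁻¹ * s * t) = ι s)
    (hD : ∀ (H : Subgroup Γ) [DecidablePred (· ∈ H)],
      Nat.card H ∣ ∑ s ∈ univ.filter (· ∉ H), ι s)
    (hHA : ∀ (H : Subgroup Γ) (θ : H →* ℂˣ),
      Nat.card H ∣ ∑ i ∈ range N, if (H ⊓ F i).subgroupOf H ≤ θ.ker then 0 else Nat.card ↥(H ⊓ F i))
    {k : Type v} [Field k] [Finite k] {ℓ : ℕ} [Fact ℓ.Prime] [CharP k ℓ]
    (hF : ∀ i ∈ range N, F i ≠ ⊤ → ¬ ℓ ∣ Nat.card (F i))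
    {m : ℕ} (τ₀ : Γ →* Matrix (Fin m) (Fin m) k) :
    Fintype.card Γ ∣ ∑ i ∈ range N, Nat.card (F i) *
      Representation.codimFixed
        ((Matrix.toLinAlgEquiv' (R := k) (n := Fin m)).toRingEquiv.toMonoidHom.comp τ₀) (F i) := by
  classical
  set τk : Representation k Γ (Fin m → k) :=
    (Matrix.toLinAlgEquiv' (R := k) (n := Fin m)).toRingEquiv.toMonoidHom.comp τ₀ with hτk
  obtain ⟨φ, hφv, hφ1, hφsum⟩ := exists_brauerCharacter (ℓ := ℓ) τ₀
  have hΓ0 : (Fintype.card Γ : ℂ) ≠ 0 := Nat.cast_ne_zero.mpr Fintype.card_ne_zero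
  -- (1) `artinSum ι g ∈ |Γ|ℤ` for every virtual character `g`
  have hvirt : ∀ g ∈ virtChars Γ, ∃ z : ℤ, artinSum ι g = (Fintype.card Γ : ℂ) * z := by
    intro g hg
    refine AddSubgroup.closure_induction
      (p := fun g _ => ∃ z : ℤ, artinSum ι g = (Fintype.card Γ : ℂ) * z) ?_ ?_ ?_ ?_ hg
    · intro χ hχ
      obtain ⟨V, _, _, _, ρ, -, rfl⟩ := hχ
      have hT := artinSum_trace_eq_natCast_sum F N ι hι ρ
        (fun i _ => Nat.cast_ne_zero.mpr (Nat.card_pos (α := F i)).ne')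
      obtain ⟨c, hc⟩ := card_dvd_sum_card_mul_codimFixed_of_brauer F N ι hι hconj hD hHA
        brauer_induction_holds ρ
      refine ⟨c, ?_⟩
      change artinSum ι (fun s => LinearMap.trace ℂ V (ρ s)) = _
      rw [hT, hc]
      push_cast
      ring
    · exact ⟨0, by rw [artinSum_zero]; simp⟩
    · rintro g g' _ _ ⟨z, hz⟩ ⟨z', hz'⟩
      exact ⟨z + z', by rw [artinSum_add, hz, hz']; push_cast; ring⟩
    · rintro g _ ⟨z, hz⟩
      refine ⟨-z, ?_⟩
      rw [show -g = (-1 : ℂ) • g by simp, artinSum_smul, hz]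
      push_cast
      ring
  obtain ⟨z, hz⟩ := hvirt φ hφv
  -- (2) `Σ_s φ(s) = |Γ| ⟨φ, 1⟩ ∈ |Γ|ℤ`
  obtain ⟨n₀, hn₀⟩ : ∃ n₀ : ℤ, ∑ s, φ s = (Fintype.card Γ : ℂ) * n₀ := by
    obtain ⟨n₀, h⟩ := exists_int_classInner_of_mem_virtChars hφv
      (character_trivial_mem_irrChars (G := Γ))
    refine ⟨n₀, ?_⟩
    rw [classInner_apply] at h
    have h1 : ∀ s : Γ, (Representation.trivial ℂ Γ ℂ).character s⁻¹ = 1 := fun s => by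
      simp [Representation.character]
    simp_rw [h1, mul_one] at h
    rw [← h, ← mul_assoc, mul_inv_cancel₀ hΓ0, one_mul]
  -- (3) the terms of the double sum
  set c : ℕ → ℕ := fun i => Representation.codimFixed τk (F i) with hc
  have hterm : ∀ i ∈ range N, ∃ a : ℤ,
      ∑ s ∈ univ.filter (· ∈ F i), (φ 1 - φ s) =
        ((Nat.card (F i) * c i : ℕ) : ℂ) + (Fintype.card Γ : ℂ) * a := by
    intro i hi
    by_cases htop : F i = ⊤
    · refine ⟨(m : ℤ) - n₀ - c i, ?_⟩
      have hfilter : univ.filter (· ∈ F i) = (univ : Finset Γ) :=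
        Finset.filter_true_of_mem fun s _ => by rw [htop]; exact Subgroup.mem_top s
      have hcardtop : Nat.card (F i) = Fintype.card Γ := by
        rw [htop, Subgroup.card_top, Nat.card_eq_fintype_card]
      rw [hfilter, Finset.sum_sub_distrib, Finset.sum_const, Finset.card_univ, nsmul_eq_mul, hn₀,
        hφ1, hcardtop]
      push_cast
      ring
    · refine ⟨0, ?_⟩
      have hsumφ := hφsum (F i) (hF i hi htop)
      rw [Finset.sum_sub_distrib, Finset.sum_const, card_filter_mem_subgroup, nsmul_eq_mul, hφ1,
        Finset.sum_subtype (univ.filter (· ∈ F i)) (p := (· ∈ F i)) (fun s => by simp), hsumφ]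
      have hci : (c i : ℂ) = (m : ℂ) - finrank k (Representation.invariants (τk.comp (F i).subtype)) := by
        rw [hc]
        change ((Representation.codimFixed τk (F i) : ℕ) : ℂ) = _
        rw [Representation.codimFixed_eq_finrank_sub, Nat.cast_sub (Submodule.finrank_le _),
          Module.finrank_fin_fun]
        rfl
      push_cast
      rw [hci]
      ring
  choose! a ha using hterm
  -- (4) assemble: `Σ_i |F_i| c_i = |Γ| (z − Σ a_i)`
  have hAS := artinSum_eq_sum_sum_filter F N ι hι φ
  rw [hz, Finset.sum_congr rfl fun i hi => ha i hi, Finset.sum_add_distrib, ← Finset.mul_sum] at hAS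
  have hT : ((∑ i ∈ range N, Nat.card (F i) * c i : ℕ) : ℂ) =
      (Fintype.card Γ : ℂ) * (z - ∑ i ∈ range N, a i) := by
    push_cast at hAS ⊢
    linear_combination -hAS
  have hZ : ((∑ i ∈ range N, Nat.card (F i) * c i : ℕ) : ℤ) =
      (Fintype.card Γ : ℤ) * (z - ∑ i ∈ range N, a i) := by
    exact_mod_cast hT
  exact Int.natCast_dvd_natCast.mp ⟨_, hZ⟩

end ModularCore

/-! ## The instantiation at a maximal ideal of a Dedekind extension -/

section Core

universe u v w

variable {K : Type u} [Field K]

open scoped Classical in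
/-- **The characteristic-`ℓ` heart: `g_0 ∣ Σ_i g_i codim (kⁿ)^{G_i}` for a matrix representation of
the inertia group over a finite field `k` of characteristic `ℓ ≠ p`**, from the two arithmetic
inputs (D), (HA) — the modular counterpart of `card_inertia_dvd_sum_of_brauer`.  Setting: `R`
Dedekind with fraction field `K`, `L/K` finite Galois with group `G`, `𝔔` a maximal ideal of
`integralClosure R L` with separable residue extension and residue characteristic `p`
(`p ∈ 𝔔`), `I = G_0 = I(𝔔)`, `G_i = 1` for `i ≥ N`; the inertia group is transported to universe
`0` (`Shrink`) and `card_dvd_sum_card_mul_codimFixed_modular` is applied: `F_0 = Γ`, and the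
`F_i = G_i`, `i ≥ 1`, are `p`-groups (`Ideal.isPGroup_ramificationSubgroup_one`), of order prime to
`ℓ` because `(p : k) ≠ 0`.
Ref: Serre, *Local Fields*, Ch. VI §2, proof of Thm 1' (p. 103); Serre, *Linear Representations*,
§18.4 Thm 43 (i); Katz, Prop. 1.9 (`A = 𝔽_λ`).
[cite: SerreLocalFields1979, Ch. VI §2, Thm 1' (proof)] [cite: Katz1988, Ch. 1, Prop. 1.9 (and its proof)] -/
theorem card_inertia_dvd_sum_modular (R : Type u) {L : Type*} [CommRing R]
    [IsDedekindDomain R] [Algebra R K] [IsFractionRing R K] [Field L] [Algebra K L]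
    [Algebra R L] [IsScalarTower R K L] [FiniteDimensional K L] [IsGalois K L]
    (𝔔 : Ideal (integralClosure R L)) [𝔔.IsMaximal]
    [Algebra.IsSeparable (R ⧸ 𝔔.under R) (integralClosure R L ⧸ 𝔔)]
    (I : Subgroup (L ≃ₐ[K] L)) (hI : I = 𝔔.inertia (L ≃ₐ[K] L))
    {N : ℕ} (hN : ∀ i, N ≤ i → 𝔔.ramificationSubgroup (L ≃ₐ[K] L) i = ⊥)
    {p : ℕ} [Fact p.Prime] (hp : (p : integralClosure R L) ∈ 𝔔)
    (hD : card_inf_inertia_dvd_finsum_lowerIndex R (K := K) (L := L))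
    (hHA : card_inf_inertia_dvd_finsum_card_inf_ramificationSubgroup R (K := K) (L := L))
    {k : Type v} [Field k] [Finite k] {ℓ : ℕ} [Fact ℓ.Prime] [CharP k ℓ] (hpk : (p : k) ≠ 0)
    {m : ℕ} (τ₀ : I →* Matrix (Fin m) (Fin m) k) :
    Nat.card I ∣ ∑ i ∈ range N, Nat.card (𝔔.ramificationSubgroup (L ≃ₐ[K] L) i) *
      Representation.codimFixed
        ((Matrix.toLinAlgEquiv' (R := k) (n := Fin m)).toRingEquiv.toMonoidHom.comp τ₀)
        ((𝔔.ramificationSubgroup (L ≃ₐ[K] L) i).comap I.subtype) := by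
  classical
  haveI : IsNoetherianRing (integralClosure R L) :=
    IsIntegralClosure.isNoetherianRing R K L (integralClosure R L)
  haveI : FaithfulSMul (L ≃ₐ[K] L) (integralClosure R L) := faithfulSMul_algEquiv_integralClosure R
  set τk : Representation k I (Fin m → k) :=
    (Matrix.toLinAlgEquiv' (R := k) (n := Fin m)).toRingEquiv.toMonoidHom.comp τ₀ with hτk
  set e : Shrink.{0} I ≃* I := Shrink.mulEquiv with he
  letI : Fintype (Shrink.{0} I) := Fintype.ofEquiv I e.toEquiv.symm
  set j : Shrink.{0} I →* (L ≃ₐ[K] L) := I.subtype.comp e.toMonoidHom with hj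
  have hjinj : Function.Injective j := Subtype.val_injective.comp e.injective
  have hjr : j.range = 𝔔.inertia (L ≃ₐ[K] L) := by
    rw [← hI]
    ext s
    constructor
    · rintro ⟨x, rfl⟩
      exact (e x).2
    · intro hs
      exact ⟨e.symm ⟨s, hs⟩, by simp [hj]⟩
  have hIj : 𝔔.inertia (L ≃ₐ[K] L) ≤ j.range := by rw [hjr]
  set F : ℕ → Subgroup (Shrink.{0} I) :=
    fun i => (𝔔.ramificationSubgroup (L ≃ₐ[K] L) i).comap j with hF
  set ι : Shrink.{0} I → ℕ := fun s => (lowerIndex 𝔔 (L ≃ₐ[K] L) (j s)).toNat with hι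
  have hιN : ∀ s, s ≠ 1 → ι s = ((range N).filter fun i => s ∈ F i).card := by
    intro s hs
    simp only [hι, hF]
    rw [lowerIndex_toNat_eq_card_filter 𝔔 hN (fun h1 => hs (hjinj (by rw [h1, map_one])))]
    rfl
  have hconj : ∀ s t : Shrink.{0} I, ι (t⁻¹ * s * t) = ι s := by
    intro s t
    simp only [hι, map_mul, map_inv]
    have ht : (j t)⁻¹ ∈ 𝔔.decompositionSubgroup (L ≃ₐ[K] L) :=
      Subgroup.inv_mem _ (𝔔.inertia_le_decompositionSubgroup (L ≃ₐ[K] L) (hjr ▸ ⟨t, rfl⟩))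
    have := lowerIndex_conj 𝔔 (s := j s) ht
    rw [inv_inv] at this
    rw [this]
  have hD' : ∀ (H : Subgroup (Shrink.{0} I)) [DecidablePred (· ∈ H)],
      Nat.card H ∣ ∑ s ∈ univ.filter (· ∉ H), ι s := by
    intro H _
    exact card_dvd_sum_lowerIndex_of 𝔔 j hjinj hjr H (hD 𝔔 (H.map j))
  have hHA' : ∀ (H : Subgroup (Shrink.{0} I)) (θ : H →* ℂˣ),
      Nat.card H ∣ ∑ i ∈ range N,
        if (H ⊓ F i).subgroupOf H ≤ θ.ker then 0 else Nat.card ↥(H ⊓ F i) := by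
    intro H θ
    exact card_dvd_sum_card_of 𝔔 j hjinj hjr hN H θ
      (hHA 𝔔 (H.map j) (θ.comp (H.equivMapOfInjective j hjinj).symm.toMonoidHom))
  -- the `F_i ≠ Γ` (so `i ≥ 1`) are `p`-groups, hence of order prime to `ℓ`
  have hP1 : IsPGroup p (𝔔.ramificationSubgroup (L ≃ₐ[K] L) 1) :=
    Ideal.isPGroup_ramificationSubgroup_one 𝔔 (L ≃ₐ[K] L) Ideal.IsPrime.ne_top' hp
  have hFℓ : ∀ i ∈ range N, F i ≠ ⊤ → ¬ ℓ ∣ Nat.card (F i) := by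
    intro i _ hne hdvd
    have hi0 : i ≠ 0 := by
      rintro rfl
      apply hne
      rw [eq_top_iff]
      intro s _
      rw [hF, Subgroup.mem_comap, Ideal.ramificationSubgroup_zero, ← hjr]
      exact ⟨s, rfl⟩
    obtain ⟨i', rfl⟩ := Nat.exists_eq_succ_of_ne_zero hi0
    obtain ⟨a, ha⟩ := (hP1.to_le (𝔔.ramificationSubgroup_antitone (L ≃ₐ[K] L)
        (Nat.succ_le_succ (Nat.zero_le i')))).exists_card_eq
    rw [hF, card_comap_ramificationSubgroup 𝔔 (L ≃ₐ[K] L) j hjinj hIj, ha] at hdvd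
    have hℓp : ℓ = p := (Nat.prime_dvd_prime_iff_eq (Fact.out : ℓ.Prime) Fact.out).mp
      ((Fact.out : ℓ.Prime).dvd_of_dvd_pow hdvd)
    apply hpk
    rw [← hℓp]
    exact CharP.cast_eq_zero k ℓ
  have hmain := card_dvd_sum_card_mul_codimFixed_modular F N ι hιN hconj hD' hHA' hFℓ
    (τ₀.comp e.toMonoidHom)
  -- translate back
  have hcardΓ : Fintype.card (Shrink.{0} I) = Nat.card I := by
    rw [← Nat.card_eq_fintype_card]
    exact Nat.card_congr e.toEquiv
  have hterm : ∀ i, Nat.card (F i) * Representation.codimFixed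
      ((Matrix.toLinAlgEquiv' (R := k) (n := Fin m)).toRingEquiv.toMonoidHom.comp
        (τ₀.comp e.toMonoidHom)) (F i) =
      Nat.card (𝔔.ramificationSubgroup (L ≃ₐ[K] L) i) *
        Representation.codimFixed τk ((𝔔.ramificationSubgroup (L ≃ₐ[K] L) i).comap I.subtype) := by
    intro i
    rw [card_comap_ramificationSubgroup 𝔔 (L ≃ₐ[K] L) j hjinj hIj i]
    congr 1
    rw [show F i = ((𝔔.ramificationSubgroup (L ≃ₐ[K] L) i).comap I.subtype).comap
      e.toMonoidHom from (Subgroup.comap_comap _ _ _).symm,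
      show (Matrix.toLinAlgEquiv' (R := k) (n := Fin m)).toRingEquiv.toMonoidHom.comp
        (τ₀.comp e.toMonoidHom) = τk.comp e.toMonoidHom from rfl, codimFixed_comp_mulEquiv]
  rw [hcardΓ, Finset.sum_congr rfl fun i _ => hterm i] at hmain
  exact hmain

open scoped Classical in
/-- **Artin's theorem for the inertia group over a finite coefficient field, from (D) and (HA)
(generic Dedekind level).**  As `exists_natCast_eq_artinExponent_core`, for a *finite* coefficient
field `A` with `(p : A) ≠ 0`, but without the finite-field input `hfin`: the characteristic-`ℓ`
branch is `card_inertia_dvd_sum_modular` (Brauer characters, Serre *LinRep* Thm 43 (i)) applied to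
a matrix model of `τ` (`exists_matrix_model`).  Proof otherwise as in the characteristic-`0` case:
`g_0 f(τ) = Σ_{i≤N} g_i codim M^{G_i}`, the `i = 0` term is a multiple of `g_0`, and for `i ≥ 1`
the codimensions are those of the matrix model.
Ref: Serre, *Local Fields*, Ch. VI §2, Thm 1' (proof); Katz, Prop. 1.9 (`A = 𝔽_λ`).
[cite: SerreLocalFields1979, Ch. VI §2, Thm 1' (proof)] [cite: Katz1988, Ch. 1, Prop. 1.9 (and its proof)] -/
theorem exists_natCast_eq_artinExponent_core_finite (R : Type u) {L : Type*} [CommRing R]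
    [IsDedekindDomain R] [Algebra R K] [IsFractionRing R K] [Field L] [Algebra K L]
    [Algebra R L] [IsScalarTower R K L] [FiniteDimensional K L] [IsGalois K L]
    (𝔔 : Ideal (integralClosure R L)) [𝔔.IsMaximal]
    [Algebra.IsSeparable (R ⧸ 𝔔.under R) (integralClosure R L ⧸ 𝔔)]
    (I : Subgroup (L ≃ₐ[K] L)) (hI : I = 𝔔.inertia (L ≃ₐ[K] L))
    {p : ℕ} [Fact p.Prime] (hp : (p : integralClosure R L) ∈ 𝔔)
    (hD : card_inf_inertia_dvd_finsum_lowerIndex R (K := K) (L := L))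
    (hHA : card_inf_inertia_dvd_finsum_card_inf_ramificationSubgroup R (K := K) (L := L))
    {A : Type v} [Field A] [Finite A] {M : Type w} [AddCommGroup M] [Module A M]
    [FiniteDimensional A M] (τ : Representation A I M) (hchar : (p : A) ≠ 0) :
    ∃ n : ℕ, (n : ℝ) = artinExponent 𝔔 (L ≃ₐ[K] L) I.subtype τ := by
  classical
  haveI : IsNoetherianRing (integralClosure R L) :=
    IsIntegralClosure.isNoetherianRing R K L (integralClosure R L)
  haveI : FaithfulSMul (L ≃ₐ[K] L) (integralClosure R L) := faithfulSMul_algEquiv_integralClosure R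
  -- Step 0: `G_i = 1` for `i ≥ N + 1`
  obtain ⟨N, hN⟩ := 𝔔.ramificationSubgroup_eventually_eq_bot_holds (L ≃ₐ[K] L)
    Ideal.IsPrime.ne_top'
  have hN' : ∀ i, N + 1 ≤ i → 𝔔.ramificationSubgroup (L ≃ₐ[K] L) i = ⊥ :=
    fun i hi => hN i ((Nat.le_succ N).trans hi)
  have hIr : 𝔔.inertia (L ≃ₐ[K] L) ≤ (I.subtype).range := by rw [Subgroup.range_subtype, hI]
  have hI0 : (0 : ℝ) < Nat.card I := Nat.cast_pos.mpr Nat.card_pos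
  -- Step 1: `f(τ) = T / g_0`, and it suffices that `g_0 ∣ T`
  rw [artinExponent_eq_sum_div 𝔔 (L ≃ₐ[K] L) I.subtype Subtype.val_injective τ hN', ← hI]
  obtain ⟨c, hc⟩ : ∃ c : ℕ → ℕ, ∀ i,
      Representation.codimFixed τ ((𝔔.ramificationSubgroup (L ≃ₐ[K] L) i).comap I.subtype) = c i :=
    ⟨_, fun _ => rfl⟩
  simp only [hc]
  suffices hdvd : Nat.card I ∣
      ∑ i ∈ range (N + 1), Nat.card (𝔔.ramificationSubgroup (L ≃ₐ[K] L) i) * c i by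
    obtain ⟨n, hn⟩ := hdvd
    exact ⟨n, by rw [hn, Nat.cast_mul, mul_div_cancel_left₀ _ hI0.ne']⟩
  -- Step 2: the `G_i`, `i ≥ 1`, are `p`-groups, so `|G_i| ≠ 0` in `A`
  have hP1 : IsPGroup p (𝔔.ramificationSubgroup (L ≃ₐ[K] L) 1) :=
    Ideal.isPGroup_ramificationSubgroup_one 𝔔 (L ≃ₐ[K] L) Ideal.IsPrime.ne_top' hp
  have hcardA : ∀ i, (Nat.card (𝔔.ramificationSubgroup (L ≃ₐ[K] L) (i + 1)) : A) ≠ 0 := by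
    intro i
    obtain ⟨a, ha⟩ := (hP1.to_le (𝔔.ramificationSubgroup_antitone (L ≃ₐ[K] L)
        (Nat.succ_le_succ (Nat.zero_le i)))).exists_card_eq
    rw [ha, Nat.cast_pow]
    exact pow_ne_zero _ hchar
  -- Step 3: reduction to the wild part
  have key : ∀ (c' : ℕ → ℕ), (∀ i ∈ range N, c' (i + 1) = c (i + 1)) →
      Nat.card I ∣ ∑ i ∈ range (N + 1), Nat.card (𝔔.ramificationSubgroup (L ≃ₐ[K] L) i) * c' i →
      Nat.card I ∣ ∑ i ∈ range (N + 1), Nat.card (𝔔.ramificationSubgroup (L ≃ₐ[K] L) i) * c i := by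
    intro c' hc' hdvd
    rw [Finset.sum_range_succ'] at hdvd ⊢
    have hG0 : Nat.card (𝔔.ramificationSubgroup (L ≃ₐ[K] L) 0) = Nat.card I := by
      rw [𝔔.ramificationSubgroup_zero, ← hI]
    rw [hG0] at hdvd ⊢
    have hS : ∑ i ∈ range N, Nat.card (𝔔.ramificationSubgroup (L ≃ₐ[K] L) (i + 1)) * c' (i + 1) =
        ∑ i ∈ range N, Nat.card (𝔔.ramificationSubgroup (L ≃ₐ[K] L) (i + 1)) * c (i + 1) :=
      Finset.sum_congr rfl fun i hi => by rw [hc' i hi]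
    rw [hS] at hdvd
    exact (Nat.dvd_add_left (dvd_mul_right _ _)).mpr
      ((Nat.dvd_add_left (dvd_mul_right _ _)).mp hdvd)
  -- Step 4: `A` is finite of prime characteristic `ℓ`; pass to a matrix model over `A`
  obtain ⟨ℓ, hℓ⟩ := CharP.exists A
  have hℓp : ℓ.Prime := (CharP.char_is_prime_or_zero A ℓ).resolve_right
    (CharP.char_ne_zero_of_finite A ℓ)
  haveI := Fact.mk hℓp
  letI : Algebra (ZMod ℓ) A := ZMod.algebra A ℓ
  obtain ⟨A₀, hft, τ₀, hmodel⟩ := exists_matrix_model (F₀ := ZMod ℓ) τ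
  set g : A₀ →+* A := algebraMap A₀ A with hg
  let τA : I →* Matrix (Fin (finrank A M)) (Fin (finrank A M)) A := (g.mapMatrix).toMonoidHom.comp τ₀
  have hdvd := card_inertia_dvd_sum_modular R 𝔔 I hI hN' hp hD hHA hchar τA
  refine key (fun i => Representation.codimFixed
      ((Matrix.toLinAlgEquiv' (R := A) (n := Fin (finrank A M))).toRingEquiv.toMonoidHom.comp τA)
      ((𝔔.ramificationSubgroup (L ≃ₐ[K] L) i).comap I.subtype)) (fun i _ => ?_) hdvd
  have h2 := (hmodel g ((𝔔.ramificationSubgroup (L ≃ₐ[K] L) (i + 1)).comap I.subtype)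
    (by rw [card_comap_ramificationSubgroup 𝔔 (L ≃ₐ[K] L) I.subtype Subtype.val_injective hIr]
        exact hcardA i)).2
  rw [← hc, Representation.codimFixed_eq_finrank_sub, Representation.codimFixed_eq_finrank_sub,
    ← h2, Module.finrank_fin_fun]

end Core

/-! ## At a prime of a number field: the finite-field fact and Artin's theorem from (D), (HA) -/

section NumberField

open scoped NumberField

universe u v w

variable {K : Type u} [Field K] {A : Type v} [Field A] {M : Type w} [AddCommGroup M] [Module A M]

/-- **The finite-field case of Artin's theorem from the two arithmetic inputs** — the named fact
`Literature.NumberTheory.GaloisRepresentations.exists_natCast_eq_artinExponent_finiteField`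
(Katz, Prop. 1.9 with `A = 𝔽_λ`; Serre, *Linear Representations*, §19.3 (iii) with Thm 44)
**follows from** the integrality of the different exponent (`card_inf_inertia_dvd_finsum_lowerIndex`,
IV §1 Cor. to Prop. 4) and of `f` on degree-one characters
(`card_inf_inertia_dvd_finsum_card_inf_ramificationSubgroup`, VI §2 Cor. to Prop. 5, i.e. Hasse–Arf)
for the finite layers of `K̄/K`: the Swan-representation argument of the printed proofs is
replaced by Brauer characters (Serre *LinRep* Thm 43 (i), `exists_brauerCharacter`) and the
characteristic-`0` theorem (Brauer induction, proved in the tree).  Instantiation at `R = 𝓞 K`,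
`L = E`, `𝔔 = 𝔓 ∩ E`, `q_v = p^f` as in `exists_natCast_eq_artinExponent_of`.
[cite: Katz1988, Ch. 1, Prop. 1.9 (and its proof)]
[cite: SerreLinearRepresentations1977, §18.4 Thm 43 (i) and §19.3]
[cite: SerreLocalFields1979, Ch. VI §2, Thm 1' (proof)] -/
theorem exists_natCast_eq_artinExponent_finiteField_of_arith
    (hD : ∀ (R : Type u) [CommRing R] [Algebra R K] (E : IntermediateField K (AlgebraicClosure K)),
      card_inf_inertia_dvd_finsum_lowerIndex R (K := K) (L := E))
    (hHA : ∀ (R : Type u) [CommRing R] [Algebra R K] (E : IntermediateField K (AlgebraicClosure K)),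
      card_inf_inertia_dvd_finsum_card_inf_ramificationSubgroup R (K := K) (L := E)) :
    exists_natCast_eq_artinExponent_finiteField (K := K) (A := A) (M := M) := by
  intro _ _ _ v 𝔓 h𝔓 E _ _ τ hchar
  classical
  haveI : 𝔓.IsMaximal := HeightOneSpectrum.isMaximal_of_mem_primesAbove h𝔓
  haveI : Finite (𝓞 K ⧸ 𝔓.under (𝓞 K)) := by
    rw [← h𝔓.2.over]
    exact Ideal.finiteQuotientOfFreeOfNeBot v.asIdeal v.ne_bot
  haveI : Algebra.IsSeparable K E := Algebra.IsSeparable.of_integral K E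
  haveI : IsGalois K E := {}
  haveI := isMaximal_comap_integralClosureToAbsIntegers (𝓞 K) 𝔓 E
  haveI := isSeparable_residue_comap (𝓞 K) 𝔓 E
  -- the residue characteristic `p` of `v`: `q_v = p ^ f`
  haveI : Finite (𝓞 K ⧸ v.asIdeal) := Ideal.finiteQuotientOfFreeOfNeBot v.asIdeal v.ne_bot
  letI : Fintype (𝓞 K ⧸ v.asIdeal) := Fintype.ofFinite _
  letI : Field (𝓞 K ⧸ v.asIdeal) := Ideal.Quotient.field _
  obtain ⟨n, hpprime, hcard⟩ := FiniteField.card (𝓞 K ⧸ v.asIdeal) (ringChar (𝓞 K ⧸ v.asIdeal))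
  haveI := Fact.mk hpprime
  have hpv : ((ringChar (𝓞 K ⧸ v.asIdeal) : ℕ) : 𝓞 K) ∈ v.asIdeal := by
    rw [← Ideal.Quotient.eq_zero_iff_mem, map_natCast]
    exact ringChar.Nat.cast_ringChar
  have hp𝔓 : ((ringChar (𝓞 K ⧸ v.asIdeal) : ℕ) : integralClosure (𝓞 K) E) ∈
      𝔓.comap (E.integralClosureToAbsIntegers (𝓞 K)) := by
    set ι := E.integralClosureToAbsIntegers (𝓞 K) with hι
    have h2 : ι ((ringChar (𝓞 K ⧸ v.asIdeal) : ℕ) : integralClosure (𝓞 K) E) =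
        ((ringChar (𝓞 K ⧸ v.asIdeal) : ℕ) : absIntegers (𝓞 K) K) := map_natCast ι _
    have h3 : ((ringChar (𝓞 K ⧸ v.asIdeal) : ℕ) : absIntegers (𝓞 K) K) =
        algebraMap (𝓞 K) (absIntegers (𝓞 K) K) (ringChar (𝓞 K ⧸ v.asIdeal)) :=
      (map_natCast _ _).symm
    have h4 : ((ringChar (𝓞 K ⧸ v.asIdeal) : ℕ) : 𝓞 K) ∈ 𝔓.under (𝓞 K) := by
      rw [← h𝔓.2.over]
      exact hpv
    show ι _ ∈ 𝔓
    rw [h2, h3]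
    exact h4
  have hq : v.residueCard = ringChar (𝓞 K ⧸ v.asIdeal) ^ (n : ℕ) := by
    rw [HeightOneSpectrum.residueCard_eq_card_quotient, Nat.card_eq_fintype_card, hcard]
  have hpA : ((ringChar (𝓞 K ⧸ v.asIdeal) : ℕ) : A) ≠ 0 := fun h0 =>
    hchar (by rw [hq, Nat.cast_pow, h0, zero_pow n.ne_zero])
  exact exists_natCast_eq_artinExponent_core_finite (𝓞 K)
    (𝔓.comap (E.integralClosureToAbsIntegers (𝓞 K))) _ rfl hp𝔓 (hD (𝓞 K) E) (hHA (𝓞 K) E) τ hpA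

/-- **Artin's integrality theorem for the inertia group at a prime of a number field, all
coefficient fields of characteristic `∤ q_v`, from the two arithmetic inputs alone** (the named
fact `exists_natCast_eq_artinExponent`, Serre VI §2 Thm 1' / Katz 1.9):
`exists_natCast_eq_artinExponent_of` with Brauer's theorem proved (`brauer_induction_holds`) and its
finite-field input supplied by `exists_natCast_eq_artinExponent_finiteField_of_arith`.
[cite: SerreLocalFields1979, Ch. VI §2, Thm 1' (proof)] [cite: Katz1988, Ch. 1, Prop. 1.9 (and its proof)] -/
theorem exists_natCast_eq_artinExponent_of_arith
    (hD : ∀ (R : Type u) [CommRing R] [Algebra R K] (E : IntermediateField K (AlgebraicClosure K)),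
      card_inf_inertia_dvd_finsum_lowerIndex R (K := K) (L := E))
    (hHA : ∀ (R : Type u) [CommRing R] [Algebra R K] (E : IntermediateField K (AlgebraicClosure K)),
      card_inf_inertia_dvd_finsum_card_inf_ramificationSubgroup R (K := K) (L := E)) :
    exists_natCast_eq_artinExponent (K := K) (A := A) (M := M) :=
  exists_natCast_eq_artinExponent_of brauer_induction_holds hD hHA
    (fun {_} _ {_} _ _ => exists_natCast_eq_artinExponent_finiteField_of_arith hD hHA)

/-- **The finite-field fact from the Hasse–Arf theorem alone**: with the different-exponent
integrality proved (`card_inf_inertia_dvd_finsum_lowerIndex_holds`) and the degree-one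
integrality reduced to Hasse–Arf (`card_inf_inertia_dvd_finsum_card_inf_ramificationSubgroup_of_hasseArf`),
`exists_natCast_eq_artinExponent_finiteField` holds granted `Literature.NumberTheory.GaloisRepresentations.hasseArf`
for the finite Galois extensions of Dedekind fraction fields in the universe of `K`.
[cite: Katz1988, Ch. 1, Prop. 1.9 (and its proof)] [cite: SerreLocalFields1979, Ch. IV §3, Theorem (Hasse–Arf)] -/
theorem exists_natCast_eq_artinExponent_finiteField_of_hasseArf
    (hHA : ∀ (R' K' L' : Type u) [CommRing R'] [Field K'] [Field L'] [Algebra R' K']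
      [Algebra R' L'] [Algebra K' L'] [IsScalarTower R' K' L'], hasseArf R' (K := K') (L := L')) :
    exists_natCast_eq_artinExponent_finiteField (K := K) (A := A) (M := M) :=
  exists_natCast_eq_artinExponent_finiteField_of_arith
    (fun R _ _ _ => card_inf_inertia_dvd_finsum_lowerIndex_holds R)
    (fun _ _ _ _ => card_inf_inertia_dvd_finsum_card_inf_ramificationSubgroup_of_hasseArf hHA)

/-- **Artin's theorem `f(τ) ∈ ℕ` for representations of the inertia group at a prime of a number
field, over every coefficient field with `(q_v : A) ≠ 0`, from the Hasse–Arf theorem alone** —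
the named fact `Literature.NumberTheory.GaloisRepresentations.exists_natCast_eq_artinExponent`
(Serre VI §2 Thm 1' with Cor. 1'; Katz 1.9) granted only
`Literature.NumberTheory.GaloisRepresentations.hasseArf` (Serre IV §3 / V §7 Thm 1) for the finite
Galois extensions of Dedekind fraction fields in the universe of `K`.  Compared with
`exists_natCast_eq_artinExponent_of_hasseArf`, the finite-field input `hfin` is gone.  Once
`hasseArf` is discharged this is `exists_natCast_eq_artinExponent_holds`.
[cite: SerreLocalFields1979, Ch. VI §2, Thm 1' (proof)] [cite: SerreLocalFields1979, Ch. IV §3, Theorem (Hasse–Arf)]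
[cite: Katz1988, Ch. 1, Prop. 1.9 (and its proof)] -/
theorem exists_natCast_eq_artinExponent_of_hasseArf'
    (hHA : ∀ (R' K' L' : Type u) [CommRing R'] [Field K'] [Field L'] [Algebra R' K']
      [Algebra R' L'] [Algebra K' L'] [IsScalarTower R' K' L'], hasseArf R' (K := K') (L := L')) :
    exists_natCast_eq_artinExponent (K := K) (A := A) (M := M) :=
  exists_natCast_eq_artinExponent_of_arith
    (fun R _ _ _ => card_inf_inertia_dvd_finsum_lowerIndex_holds R)
    (fun _ _ _ _ => card_inf_inertia_dvd_finsum_card_inf_ramificationSubgroup_of_hasseArf hHA)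

end NumberField

/-! ## Consequences: the corrected Artin–Katz integrality statements from Hasse–Arf alone -/

namespace GaloisRep

open scoped NumberField

universe u v w

variable {K : Type u} [Field K]

/-- **The corrected Artin–Katz integrality statement from the Hasse–Arf theorem alone, all
coefficient characteristics `≠ p`.**  `exists_natCast_eq_artinConductorAt_of_hasOpenInertiaKerAt`
(`ArtinConductor.lean`; Katz, Prop. 1.9; Serre VI §2 Thm 1') granted `hasseArf` only — the
finite-field input of `exists_natCast_eq_artinConductorAt_of_hasOpenInertiaKerAt_of_hasseArf` is
supplied by `exists_natCast_eq_artinExponent_finiteField_of_hasseArf`.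
[cite: Katz1988, Ch. 1, Prop. 1.9 (and its proof)] [cite: SerreLocalFields1979, Ch. VI §2, Thm 1' (proof)] -/
theorem exists_natCast_eq_artinConductorAt_of_hasOpenInertiaKerAt_of_hasseArf'
    {A : Type v} [Field A] [TopologicalSpace A] {M : Type w} [AddCommGroup M] [Module A M]
    [TopologicalSpace M]
    (hHA : ∀ (R' K' L' : Type u) [CommRing R'] [Field K'] [Field L'] [Algebra R' K']
      [Algebra R' L'] [Algebra K' L'] [IsScalarTower R' K' L'], hasseArf R' (K := K') (L := L')) :
    GaloisRep.exists_natCast_eq_artinConductorAt_of_hasOpenInertiaKerAt.{u, v, w}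
      (K := K) (A := A) (M := M) :=
  exists_natCast_eq_artinConductorAt_of_hasOpenInertiaKerAt_of_hasseArf hHA
    (fun {_} _ {_} _ _ => exists_natCast_eq_artinExponent_finiteField_of_hasseArf hHA)

/-- **The Hausdorff form of the conductor-exponent specification, all characteristics `≠ p`, from
the Hasse–Arf theorem alone** (`natCast_artinConductorExponent_of_t2Space_of_hasseArf` without its
finite-field input). [cite: Katz1988, Ch. 1, Prop. 1.9 (proof) and Remark 1.10]
[cite: SerreLocalFields1979, Ch. VI §2, Thm 1' and Ch. IV §3, Theorem (Hasse–Arf)] -/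
theorem natCast_artinConductorExponent_of_t2Space_of_hasseArf'
    (hHA : ∀ (R' K' L' : Type u) [CommRing R'] [Field K'] [Field L'] [Algebra R' K']
      [Algebra R' L'] [Algebra K' L'] [IsScalarTower R' K' L'], hasseArf R' (K := K') (L := L'))
    [NumberField K] {A : Type v} [Field A] [TopologicalSpace A] {M : Type w}
    [AddCommGroup M] [Module A M] [TopologicalSpace M] [T2Space M] [FiniteDimensional A M]
    {v : HeightOneSpectrum (𝓞 K)} {𝔓 : Ideal (absIntegers (𝓞 K) K)} (h𝔓 : 𝔓 ∈ v.primesAbove)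
    (ρ : GaloisRep K A M) (hchar : (v.residueCard : A) ≠ 0) (hρ : ρ.HasFiniteWildImageAt (𝓞 K) 𝔓) :
    (ρ.artinConductorExponent v : ℝ) = ρ.artinConductorAt (𝓞 K) 𝔓 :=
  natCast_artinConductorExponent_of_t2Space_of_hasseArf hHA
    (fun {_} _ {_} _ _ => exists_natCast_eq_artinExponent_finiteField_of_hasseArf hHA) h𝔓 ρ hchar hρ

/-- **The finite-quotient form `natCast_artinConductorExponent_of_hasOpenInertiaKerAt` (Katz 1.9 as
printed), all characteristics `≠ p`, from the Hasse–Arf theorem alone.**  With `hasseArf_holds`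
this is the discharge `natCast_artinConductorExponent_of_hasOpenInertiaKerAt_holds`.
[cite: Katz1988, Ch. 1, Prop. 1.9 (and its proof)]
[cite: SerreLocalFields1979, Ch. VI §2 Thm 1', §3, and Ch. IV §3, Theorem (Hasse–Arf)] -/
theorem natCast_artinConductorExponent_of_hasOpenInertiaKerAt_of_hasseArf'
    (hHA : ∀ (R' K' L' : Type u) [CommRing R'] [Field K'] [Field L'] [Algebra R' K']
      [Algebra R' L'] [Algebra K' L'] [IsScalarTower R' K' L'], hasseArf R' (K := K') (L := L'))
    [NumberField K] : natCast_artinConductorExponent_of_hasOpenInertiaKerAt.{u, v, w} (K := K) :=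
  natCast_artinConductorExponent_of_hasOpenInertiaKerAt_of_hasseArf hHA
    (fun {_} _ {_} _ _ => exists_natCast_eq_artinExponent_finiteField_of_hasseArf hHA)

end GaloisRep

end Literature.NumberTheory.GaloisRepresentations
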